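import Summits.QuantumFields.YangMills.Theorems.IR.BlockedActivityWLocChainData
import HarnessLib

/-!
# Crux `IR` (stmt-QuantumFields-19354), lane B «strong coupling AFTER BLOCKING»: the LOCAL class is inhabited along chains —
# signed-label transmission realises any summable mode superposition EXACTLY, at radius `Σ_i s_i^{1∕(L+1)}` (part 4: the representation)

Helper module for item `stmt-QuantumFields-19354` (`--supports`; it closes nothing), lane `ym-19354-onsetsc-p2` (g4), part 4 of 4 (parts 1–3:
`BlockedActivityWLocChainLaw` — the label reference, double centring, the chain sum; `…ChainFactors` — the factors, vanishing of proper
sub-products, normaliser `1`, numerator = mode sum; `…ChainData` — chain data of a region, cell σ-algebras, finite range, locality, bounds), on the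
located open question Q-loc of the lane (g3, `CURRENCY-MEMO-g3.md`): is the LOCAL W-class `BlockedRepOnLoc` (p547052: `BlockedRepOn` + the finite range
`local_g` of the exterior dependence) realisable once the exterior datum must be read FAR from the centre?  The W-class of record is inhabited by
single-cell tilts (`blockedRepOn_of_tilt`, p555575), which read the datum AT the centre and therefore never satisfy `local_g` when the centre is
interior; the only inhabitants of the local classes so far are the `b⁻⁴`-receding strong-coupling regroupings (`blockedActivityClassWLoc_of_mesh_threshold`).

THE MECHANISM (this file).  Let `c₀ = 0, c₁, …, c_{m+1}` be a chain of distinct cells, consecutive ones `CellAdj`-adjacent, and let the reading cell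
`c_{m+1}` be adjacent to a set `T` of cells outside `Y`.  Suppose the centre response of the kernel `γ_σ = ymSpecification ρ β (regionEdges w Y) σ`
over the data `σ ∈ S` is a summable superposition of product modes read on `T`:
  `∫ f dγ_σ = ∫ f dγ_τ + Σ_i t_i^{m+2} · ψ_i(σ) · ∫ f φ_i dγ_τ`   (`|φ_i|, |ψ_i| ≤ 1`, `ψ_i` reads `σ` only on the cells of `T`, `t_i ≥ 0`,
  `Σ_i t_i = Z ≤ 1∕2`; i.e. mode weights `s_i = t_i^{m+2}` with ROOT functional `Z = Σ_i s_i^{1∕(m+2)}`).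
Then `BlockedRepOnLoc ρ β w Y Z S` is inhabited (`blockedRepOnLoc_of_chainData`), by the following σ-INDEPENDENT reference: the `m+1` bonds of the
chain carry i.i.d. SIGNED LABELS `(i, ±)` with `P(i, ±) = t_i∕(2Z)`; the cell σ-algebra of `c_k` is generated by the labels of its (one or two)
bonds, so NON-TOUCHING cell sets read disjoint label sets and are independent (Mathlib `iIndepFun_pi`, `indep_iSup_of_disjoint`) — the finite-range
axiom of the Kotecký–Preiss layer holds with teeth, not vacuously; the factor of an interior cell is `Z · 1[labels agree] · (product of its two
signs)`, the factor of the reading cell is `2Z t_i ψ_i(σ) · sign`, and the centre observable is realised on cell `0` as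
`∫ f dγ_τ + ½ · sign · ∫ f (φ_i − ∫φ_i dγ_τ) dγ_τ` (values in `[0,1]`).  DOUBLE CENTRING: every proper sub-product of factors contains a bond sign
exactly once and integrates to zero (a sign flip is a mass-preserving involution of the label space, `integral_eq_zero_of_odd`); the normaliser is
EXACTLY `1` (`den_eq_one`) and the full chain reproduces the mode sum (`integral_full_chain`: all labels must agree, probability `(t_i∕Z)^{m+1}`,
compensated by the factors `Z^{m+1} · 2Z t_i`, signs squaring to `1`).  All factors are bounded by `Z`: the activity radius of an `(m+2)`-cell chain
is the root functional `Σ_i s_i^{1∕(m+2)}` of the mode weights — NOT their sum.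

WHAT THIS SAYS FOR Q-loc (honest).  (1) The local class is NOT vacuous beyond tilts: exterior information can be carried to the centre EXACTLY through
σ-independent interior factors of an independent reference over any distance, which the single-cell tilt cannot do.  (2) The price is the root
functional: the Horn–Hölder inequality for singular values of products shows `Σ_i s_i^{2∕(m+2)} ≲ Z²` is NECESSARY for any single-file design
(desk note `Q-LOC-ARCH-g4.md`, evidence on the item), so `Z = Σ_i s_i^{1∕(m+2)}` is the right order.  (3) Supplying the mode decomposition for the
actual Wilson kernels (strong coupling: cluster ∕ transfer-operator spectral input; tubes `Y = {0, e₁, …, n e₁}` are the chain geometry, `tubeCell`,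
`tipCells`) and the BRANCHED version for regions with several reading cells (routing trees) are the open parts of Q-loc — not claimed here.

HONEST FRAMING: a format ∕ mechanism theorem about the lane's own currency (the LOCAL class of p547052); nothing about weak coupling, a gap or Clay.
No `sorry`; axioms ⊆ {propext, Classical.choice, Quot.sound}; no instances, no notation.
Refs: KoteckyPreiss1986; FriedliVelenik2017 §5.7.1 (the input format); BauerschmidtBrydgesSlade2019 §3.3 (finite range ⇒ factorisation);
owner rulings R103 ∕ R118 ∕ R119 (currency of record); g3 CURRENCY-MEMO (Q-loc).
-/

set_option autoImplicit false

noncomputable section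

open MeasureTheory ProbabilityTheory Finset
open scoped ENNReal
open Literature.MathematicalPhysics.QuantumFieldTheory Literature.MathematicalPhysics.QuantumLattice
open Literature.Probability.LatticeModels (IsLocalPerturbation IsLocalObservable pertExpect pertNum pertZ Touches)
open Summit.QuantumFields.YangMills.Cruxes.IR.Tempered (cellEdges windowCells regionEdges)

namespace Summit.QuantumFields.YangMills.Cruxes.IR.BlockedActivity

/-! ## §4 (continued) The representation -/

section Rep

open Chain

variable {G : Type} [Group G] [TopologicalSpace G] [IsTopologicalGroup G] [CompactSpace G]
  [MeasurableSpace G] [BorelSpace G] {N : ℕ} {ρ : G →* Matrix (Fin N) (Fin N) ℂ} {β : ℝ}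
  {w : Fin 4 → ℤ → ℤ} {Y : Finset Cell} {S : Set (LGConfig 4 G)} {m : ℕ}

namespace ChainData

variable (X : ChainData ρ β w Y S m)

/-- **THE REPRESENTATION**: chain data for `Y` over `S` with root functional `Z` give `BlockedRepOnLoc ρ β w Y Z S` — reference = independent signed
labels on the bonds, cell σ-algebras = labels of the bonds read, perturbed cells `c₁, …, c_{m+1}`, factors `cellFac`, observable `obs`. -/
def toRep [SecondCountableTopology G] (hρ : Continuous ρ) : BlockedRepOnLoc ρ β w Y X.W.Z S where
  Ω := BondCfg m
  mΩ := inferInstance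
  μ := X.W.chainLaw m
  isProb := X.W.isProbabilityMeasure_chainLaw m
  𝓕 := X.cellSigma
  C := X.C
  g := X.cellFac
  obs := X.obs
  perturbation σ _ :=
    { le := fun p => iSup₂_le fun j _ => (measurable_pi_apply j).comap_le
      indep := X.indep_cellSigma
      measurable := X.measurable_cellFac σ
      norm_le := fun p b => by
        by_cases h : ∃ k : Fin (m + 1), X.c k.succ = p
        · obtain ⟨k, rfl⟩ := h
          rw [cellFac_pos, Complex.norm_real, Real.norm_eq_abs]
          exact X.W.abs_fac_le (fun i => X.ψ_bdd i σ) k b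
        · unfold cellFac; rw [dif_neg h, norm_zero]; exact X.W.Z_pos.le
      nonneg := X.W.Z_pos.le }
  obs_local f hf := by
    refine ⟨?_, fun b => ?_⟩
    · have hfun : X.obs f = (fun l : Label => ((obsR (m := m) (∫ U, f U ∂X.γτ)
          (fun i => ∫ U, f U * (X.φ i U - ∫ V, X.φ i V ∂X.γτ) ∂X.γτ) (fun _ => l) : ℝ) : ℂ)) ∘ fun b : BondCfg m => b 0 := by
        funext b; simp only [obs, obsR, Function.comp]
      rw [hfun]
      have hm : Measurable[X.cellSigma 0] (fun b : BondCfg m => b 0) := X.measurable_eval X.zero_mem_verts_zero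
      exact (measurable_of_countable _).comp (hm.mono (le_iSup₂ (f := fun p (_ : p ∈ ({0} : Finset Cell)) => X.cellSigma p) 0
        (mem_singleton_self 0)) le_rfl)
    · obtain ⟨h0, h1⟩ := X.obsR_mem hρ hf b
      simp only [obs, Complex.norm_real, Real.norm_eq_abs]
      rw [abs_of_nonneg h0]; exact h1
  local_g p σ σ' h := X.cellFac_local p σ σ' h
  rep σ hσ f hf := by
    haveI := isProbabilityMeasure_ymSpecification ρ hρ β (regionEdges w Y) X.τ
    haveI := X.W.isProbabilityMeasure_chainLaw m
    have hη : ∀ i, |X.ψ i σ| ≤ 1 := fun i => X.ψ_bdd i σ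
    set A : ℝ := ∫ U, f U ∂X.γτ with hA
    set D : ℕ → ℝ := fun i => ∫ U, f U * (X.φ i U - ∫ V, X.φ i V ∂X.γτ) ∂X.γτ with hD
    have hDb : ∀ i, |D i| ≤ 2 := fun i =>
      ((X.abs_modeIntegral_le hρ hf i).1).trans (by linarith [(X.integral_centreObs_mem hρ hf).2])
    -- denominator and numerator
    have hden : pertZ (X.W.chainLaw m) (X.cellFac σ) X.C = 1 := by
      unfold pertZ
      simp_rw [X.prod_cellFac σ]
      rw [integral_complex_ofReal, X.W.den_eq_one hη, Complex.ofReal_one]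
    have hnum : pertNum (X.W.chainLaw m) (X.cellFac σ) (X.obs f) X.C =
        ((A + ∑' i, X.W.t i ^ (m + 2) * X.ψ i σ * D i : ℝ) : ℂ) := by
      unfold pertNum
      simp_rw [X.prod_cellFac σ, obs, ← Complex.ofReal_mul]
      rw [integral_complex_ofReal, X.W.num_eq hη A D zero_le_two hDb]
    rw [pertExpect, hnum, hden, div_one, X.rep σ hσ f hf]
    congr 1
    rw [← hA, add_right_inj]
    -- `∫ f φ_i = D_i + (∫ φ_i) A`, and `Σ t^{m+2} ψ_i ∫ φ_i = 0` from the decomposition at `f ≡ 1`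
    have hfm : Measurable f := hf.2.1
    have hfi : Integrable f X.γτ := Integrable.of_bound hfm.aestronglyMeasurable 1
      (ae_of_all _ fun U => by rw [Real.norm_eq_abs, abs_of_nonneg (hf.2.2 U).1]; exact (hf.2.2 U).2)
    have hfφ : ∀ i, Integrable (fun U => f U * X.φ i U) X.γτ := fun i =>
      Integrable.of_bound (hfm.mul (X.φ_meas i)).aestronglyMeasurable 1
        (ae_of_all _ fun U => by
          rw [Real.norm_eq_abs, abs_mul, abs_of_nonneg (hf.2.2 U).1]
          calc f U * |X.φ i U| ≤ 1 * 1 := mul_le_mul (hf.2.2 U).2 (X.φ_bdd i U) (abs_nonneg _) zero_le_one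
            _ = 1 := one_mul _)
    have hDi : ∀ i, D i = ∫ U, f U * X.φ i U ∂X.γτ - (∫ V, X.φ i V ∂X.γτ) * A := fun i => by
      simp only [hD]
      have : ∀ U, f U * (X.φ i U - ∫ V, X.φ i V ∂X.γτ) = f U * X.φ i U - (∫ V, X.φ i V ∂X.γτ) * f U := fun U => by ring
      simp_rw [this]
      rw [integral_sub (hfφ i) (hfi.const_mul _), integral_const_mul]
    -- the decomposition at `f ≡ 1`
    have h1 : IsCentreObs w (fun _ : LGConfig 4 G => (1 : ℝ)) :=
      ⟨fun _ _ _ => rfl, measurable_const, fun _ => ⟨zero_le_one, le_rfl⟩⟩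
    have hone := X.rep σ hσ (fun _ => (1 : ℝ)) h1
    haveI := isProbabilityMeasure_ymSpecification ρ hρ β (regionEdges w Y) σ
    simp only [integral_const, probReal_univ, smul_eq_mul, mul_one, one_mul] at hone
    have hsum0 : ∑' i, X.W.t i ^ (m + 2) * X.ψ i σ * ∫ V, X.φ i V ∂X.γτ = 0 := by linarith
    -- summability of the mode sums (`t_i^{m+2} ≤ t_i`)
    have htpow : ∀ i, X.W.t i ^ (m + 2) ≤ X.W.t i := fun i =>
      pow_le_of_le_one (X.W.t_nonneg i) ((X.W.t_le_Z i).trans X.W.Z_le_one) (Nat.succ_ne_zero _)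
    have hsm : ∀ (u : ℕ → ℝ) (Cu : ℝ), (∀ i, |u i| ≤ Cu) → Summable fun i => X.W.t i ^ (m + 2) * X.ψ i σ * u i := fun u Cu hu =>
      Summable.of_norm_bounded ((X.W.hasSum_t.summable.mul_right Cu)) fun i => by
        rw [Real.norm_eq_abs, abs_mul, abs_mul, abs_of_nonneg (pow_nonneg (X.W.t_nonneg i) _)]
        have hCu : 0 ≤ Cu := (abs_nonneg _).trans (hu 0)
        calc X.W.t i ^ (m + 2) * |X.ψ i σ| * |u i| ≤ X.W.t i * 1 * Cu := by
              apply mul_le_mul _ (hu i) (abs_nonneg _) (by rw [mul_one]; exact X.W.t_nonneg i)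
              exact mul_le_mul (htpow i) (hη i) (abs_nonneg _) (X.W.t_nonneg i)
          _ = X.W.t i * Cu := by ring
    have hm1 : ∀ i, |∫ V, X.φ i V ∂X.γτ| ≤ 1 := fun i => by
      calc |∫ V, X.φ i V ∂X.γτ| ≤ ∫ V, |X.φ i V| ∂X.γτ := abs_integral_le_integral_abs
        _ ≤ ∫ _V, (1 : ℝ) ∂X.γτ := integral_mono_of_nonneg (ae_of_all _ fun V => abs_nonneg _) (integrable_const _)
            (ae_of_all _ fun V => X.φ_bdd i V)
        _ = 1 := by simp
    have hfφ1 : ∀ i, |∫ U, f U * X.φ i U ∂X.γτ| ≤ 1 := fun i => by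
      calc |∫ U, f U * X.φ i U ∂X.γτ| ≤ ∫ U, |f U * X.φ i U| ∂X.γτ := abs_integral_le_integral_abs
        _ ≤ ∫ _U, (1 : ℝ) ∂X.γτ := integral_mono_of_nonneg (ae_of_all _ fun U => abs_nonneg _) (integrable_const _)
            (ae_of_all _ fun U => by
              show |f U * X.φ i U| ≤ 1
              rw [abs_mul, abs_of_nonneg (hf.2.2 U).1]
              calc f U * |X.φ i U| ≤ 1 * 1 := mul_le_mul (hf.2.2 U).2 (X.φ_bdd i U) (abs_nonneg _) zero_le_one
                _ = 1 := one_mul _)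
        _ = 1 := by simp
    have hAabs : |A| ≤ 1 := by
      rw [abs_of_nonneg (X.integral_centreObs_mem hρ hf).1]; exact (X.integral_centreObs_mem hρ hf).2
    have hsplit : ∀ i, X.W.t i ^ (m + 2) * X.ψ i σ * D i =
        X.W.t i ^ (m + 2) * X.ψ i σ * ∫ U, f U * X.φ i U ∂X.γτ - A * (X.W.t i ^ (m + 2) * X.ψ i σ * ∫ V, X.φ i V ∂X.γτ) := fun i => by
      rw [hDi]; ring
    simp_rw [hsplit]
    rw [Summable.tsum_sub (hsm _ 1 hfφ1) ((hsm _ 1 hm1).mul_left A), tsum_mul_left, hsum0, mul_zero, sub_zero]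

end ChainData

/-- **Q-loc along chains**: chain data for `Y` over `S` inhabit the LOCAL class `BlockedRepOnLoc ρ β w Y Z S` at the root functional
`Z = Σ_i s_i^{1∕(m+2)}` of the mode weights `s_i = t_i^{m+2}`. -/
theorem blockedRepOnLoc_of_chainData [SecondCountableTopology G] (hρ : Continuous ρ) (X : ChainData ρ β w Y S m) :
    Nonempty (BlockedRepOnLoc ρ β w Y X.W.Z S) :=
  ⟨X.toRep hρ⟩

/-! ## §5 The tube geometry: the axis chain and its tip -/

/-- The axis cell `k e₁`. -/
def tubeCell (k : ℕ) : Cell := fun i => if i = 0 then (k : ℤ) else 0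

/-- `tubeCell 0 = 0`. -/
theorem tubeCell_zero : tubeCell 0 = 0 := by
  funext i; simp [tubeCell]

/-- Consecutive axis cells are adjacent. -/
theorem cellAdj_tubeCell_succ (k : ℕ) : CellAdj (tubeCell k) (tubeCell (k + 1)) := fun i => by
  unfold tubeCell; split_ifs <;> simp

/-- The axis cells are distinct. -/
theorem tubeCell_injective : Function.Injective tubeCell := fun _ _ h => by
  have := congrFun h 0; simpa [tubeCell] using this

/-- The axis chain `0, e₁, …, (m+1) e₁` as chain cells. -/
def tubeChain (m : ℕ) (k : Fin (m + 2)) : Cell := tubeCell k.val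

/-- It starts at the centre. -/
theorem tubeChain_zero (m : ℕ) : tubeChain m 0 = 0 := tubeCell_zero

/-- Consecutive cells of the axis chain are adjacent. -/
theorem tubeChain_adj (m : ℕ) (k : Fin (m + 1)) : CellAdj (tubeChain m k.castSucc) (tubeChain m k.succ) := by
  unfold tubeChain; rw [Fin.val_succ, Fin.val_castSucc]; exact cellAdj_tubeCell_succ k.val

/-- The axis chain is injective. -/
theorem tubeChain_injective (m : ℕ) : Function.Injective (tubeChain m) := fun _ _ h =>
  Fin.ext (tubeCell_injective h)

/-- The TIP of the tube of length `m+1`: the `27` cells `((m+2), j₂, j₃, j₄)`, `|j_i| ≤ 1`, just beyond the reading cell `(m+1) e₁`. -/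
def tipCells (m : ℕ) : Finset Cell := (cellNbr (tubeCell (m + 1))).filter fun q => q 0 = (m : ℤ) + 2

/-- Tip cells are adjacent to the reading cell. -/
theorem cellAdj_of_mem_tipCells {m : ℕ} {q : Cell} (hq : q ∈ tipCells m) : CellAdj q (tubeChain m (Fin.last (m + 1))) := by
  have hq' := (mem_filter.1 hq).1
  unfold cellNbr at hq'
  rw [Fintype.mem_piFinset] at hq'
  intro i
  have hi := mem_Icc.1 (hq' i)
  show |q i - tubeCell (m + 1) i| ≤ 1
  rw [abs_le]; constructor <;> linarith [hi.1, hi.2]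

/-- Tip cells are not axis cells `k e₁`, `k ≤ m+1` (their first coordinate is `m+2`). -/
theorem tipCells_not_mem_tube {m : ℕ} {q : Cell} (hq : q ∈ tipCells m) {Y : Finset Cell}
    (hY : ∀ p ∈ Y, p 0 ≤ (m : ℤ) + 1) : q ∉ Y := fun h => by
  have h0 := (mem_filter.1 hq).2
  have := hY q h
  omega

/-- **Tube corollary.**  For a region `Y` all of whose cells have first coordinate `≤ m+1` (e.g. the tube `{0, e₁, …, (m+1) e₁}`), a mode decomposition
of the centre response read on the tip `tipCells m` along the axis chain gives the local class at the root functional — the data to supply are exactly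
the fields of `ChainData` with `c = tubeChain m`, `T = tipCells m`. -/
theorem blockedRepOnLoc_tube [SecondCountableTopology G] (hρ : Continuous ρ) (hY : ∀ p ∈ Y, p 0 ≤ (m : ℤ) + 1) (W : Chain.Weights)
    (φ : ℕ → LGConfig 4 G → ℝ) (hφm : ∀ i, Measurable (φ i)) (hφb : ∀ i U, |φ i U| ≤ 1)
    (ψ : ℕ → LGConfig 4 G → ℝ) (hψb : ∀ i σ, |ψ i σ| ≤ 1)
    (hψloc : ∀ i, ∀ σ σ' : LGConfig 4 G, (∀ q ∈ tipCells m, ∀ e ∈ cellEdges w q, σ e = σ' e) → ψ i σ = ψ i σ')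
    (τ : LGConfig 4 G)
    (hrep : ∀ σ ∈ S, ∀ f : LGConfig 4 G → ℝ, IsCentreObs w f →
      ∫ U, f U ∂(ymSpecification ρ β (regionEdges w Y) σ) =
        ∫ U, f U ∂(ymSpecification ρ β (regionEdges w Y) τ) +
          ∑' i, W.t i ^ (m + 2) * ψ i σ * ∫ U, f U * φ i U ∂(ymSpecification ρ β (regionEdges w Y) τ)) :
    Nonempty (BlockedRepOnLoc ρ β w Y W.Z S) :=
  blockedRepOnLoc_of_chainData hρ
    { c := tubeChain m
      c_zero := tubeChain_zero m
      adj := tubeChain_adj m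
      inj := tubeChain_injective m
      T := tipCells m
      T_adj := fun _ hq => cellAdj_of_mem_tipCells hq
      T_out := fun _ hq => tipCells_not_mem_tube hq hY
      W := W
      φ := φ
      φ_meas := hφm
      φ_bdd := hφb
      ψ := ψ
      ψ_bdd := hψb
      ψ_loc := hψloc
      τ := τ
      rep := hrep }

end Rep

end Summit.QuantumFields.YangMills.Cruxes.IR.BlockedActivity

end
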